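import Literature.NumberTheory.EllipticCurves.BinaryQuarticDiscriminantLiftProofs
import Literature.NumberTheory.EllipticCurves.BinaryQuarticMeasure
import HarnessLib

/-!
# The density of `W_p = {p² ∣ Δ}` in `V_{ℤ_p}`: `μ_p{f : p² ∣ Δ(f)} ≤ 10/p²`

`Proofs` companion (theorems only) of `BinaryQuarticDiscriminantLiftProofs.lean` (the count
`#{f ∈ V(ℤ/p²) : Δ(f) = 0} ≤ 10p⁸`) and `BinaryQuarticMeasure.lean` (the normalised measure `μ_p`
on `V_{ℤ_p} = ℤ_p⁵`). Source: M. Bhargava, A. Shankar, *Binary quartic forms having bounded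
invariants, and the boundedness of the average rank of elliptic curves*, Ann. of Math. (2) 181
(2015) 191–242, proof of Thm 2.21 of the published version (= arXiv:1006.1002v3): "since `φ` is
acceptable we have `1 − ∫_{V_{ℤ_p}} φ_p(f) df ≤ ∫_{f ∈ V_{ℤ_p}, p² ∣ Δ(f)} df ≪ p⁻²` for
sufficiently large `p` (see, for example, [BPS, Proof of Theorem 3.2])" — the estimate that makes
`∏_p ∫ φ_p` converge and controls the tail `∑_{p > Y}` in the square-free sieve.

## Contents

* `volume_setOf_toZModPow_eq`: a residue class modulo `pⁿ` in `ℤ_p` has measure `p⁻ⁿ`;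
  `volume_setOf_map_toZModPow_eq`: a residue class of forms modulo `pⁿ` in `V_{ℤ_p}` has measure
  `p⁻⁵ⁿ`.
* `sq_dvd_disc_iff_disc_map_toZModPow` (`p² ∣ Δ(f)` iff `Δ(f mod p²) = 0`),
  `isClosed_setOf_sq_dvd_disc`, `measurableSet_setOf_sq_dvd_disc`.
* `padicInt_volume_setOf_sq_dvd_disc_le`: **`μ_p{f ∈ V_{ℤ_p} : p² ∣ Δ(f)} ≤ 10·p⁻²` for every
  prime `p`** (in `ℝ≥0∞`), and its real-valued form `padicInt_volume_real_setOf_sq_dvd_disc_le`.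

## References

* M. Bhargava, A. Shankar, Ann. of Math. (2) 181 (2015), §2.7, proof of Thm 2.21 of the published
  version (= arXiv:1006.1002v3). [cite: BhargavaShankarAnnals2015, §2.7, proof of Thm 2.21 (published numbering)]
* K. Belabas, M. Bhargava, C. Pomerance, Duke Math. J. 153 (2010) (`BPS`, cited through the source).
-/

noncomputable section

open scoped Classical

namespace Literature.NumberTheory.EllipticCurves

namespace BinaryQuartic

open _root_.MeasureTheory Set Metric
open scoped ENNReal

section Density

variable {p : ℕ} [hp : Fact p.Prime]

/-- The fibre of `ℤ_p → ℤ/pⁿ` over a residue class is the closed ball of radius `p⁻ⁿ` about any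
lift. [folklore] -/
theorem setOf_toZModPow_eq (n : ℕ) (c : ZMod (p ^ n)) :
    {x : ℤ_[p] | PadicInt.toZModPow n x = c} =
      closedBall ((c.val : ℕ) : ℤ_[p]) ((p : ℝ) ^ (-(n : ℤ))) := by
  ext x
  rw [mem_setOf_eq, mem_closedBall, dist_eq_norm, PadicInt.norm_le_pow_iff_mem_span_pow,
    ← PadicInt.ker_toZModPow, RingHom.mem_ker, map_sub, map_natCast, ZMod.natCast_zmod_val,
    sub_eq_zero]

/-- **Each residue class modulo `pⁿ` has Haar measure `p⁻ⁿ` in `ℤ_p`.** [folklore] -/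
theorem volume_setOf_toZModPow_eq (n : ℕ) (c : ZMod (p ^ n)) :
    volume {x : ℤ_[p] | PadicInt.toZModPow n x = c} = ((p : ℝ≥0∞) ^ n)⁻¹ := by
  rw [setOf_toZModPow_eq, Literature.MeasureTheory.Group.padicInt_volume_closedBall]

/-- **Each residue class of forms modulo `pⁿ` has measure `p⁻⁵ⁿ` in `V_{ℤ_p}`** (the measure `μ_p`
of `BinaryQuarticMeasure.lean`, the product of the Haar probability measures on the five
coefficients). [folklore] -/
theorem volume_setOf_map_toZModPow_eq (n : ℕ) (F : BinaryQuartic (ZMod (p ^ n))) :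
    volume {f : BinaryQuartic ℤ_[p] | f.map (PadicInt.toZModPow n) = F} =
      (((p : ℝ≥0∞) ^ n)⁻¹) ^ 5 := by
  rw [volume_eq_volume_image_coeffs]
  have hset : coeffs '' {f : BinaryQuartic ℤ_[p] | f.map (PadicInt.toZModPow n) = F} =
      Set.pi univ fun i => {x : ℤ_[p] | PadicInt.toZModPow n x = F.coeffs i} := by
    ext v
    simp only [mem_image, mem_setOf_eq, mem_univ_pi]
    constructor
    · rintro ⟨f, hf, rfl⟩ i
      rw [← coeffs_map, hf]
    · intro hv
      refine ⟨equivFin5.symm v, ?_, equivFin5.apply_symm_apply v⟩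
      apply coeffs_injective
      funext i
      rw [coeffs_map, show (equivFin5.symm v).coeffs i = v i from
        congrFun (equivFin5.apply_symm_apply v) i]
      exact hv i
  rw [hset, volume_pi_pi]
  simp only [volume_setOf_toZModPow_eq, Finset.prod_const, Finset.card_univ, Fintype.card_fin]

/-- `W_p ∩ V_{ℤ_p}`-membership is reduction into the zeros of `Δ` modulo `p²`:
`p² ∣ Δ(f)` iff `Δ(f mod p²) = 0`. [folklore] -/
theorem sq_dvd_disc_iff_disc_map_toZModPow (f : BinaryQuartic ℤ_[p]) :
    (p : ℤ_[p]) ^ 2 ∣ f.disc ↔ (f.map (PadicInt.toZModPow 2)).disc = 0 := by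
  rw [disc_map, ← RingHom.mem_ker, PadicInt.ker_toZModPow, Ideal.mem_span_singleton]

/-- The set `{f ∈ V_{ℤ_p} : p² ∣ Δ(f)}` is closed (hence measurable). [folklore] -/
theorem isClosed_setOf_sq_dvd_disc :
    IsClosed {f : BinaryQuartic ℤ_[p] | (p : ℤ_[p]) ^ 2 ∣ f.disc} := by
  have : {f : BinaryQuartic ℤ_[p] | (p : ℤ_[p]) ^ 2 ∣ f.disc} =
      (fun f : BinaryQuartic ℤ_[p] => f.disc) ⁻¹' closedBall 0 ((p : ℝ) ^ (-(2 : ℤ))) := by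
    ext f
    simp only [mem_setOf_eq, mem_preimage, mem_closedBall, dist_zero_right]
    rw [show (-(2 : ℤ)) = -((2 : ℕ) : ℤ) by norm_num, PadicInt.norm_le_pow_iff_mem_span_pow,
      Ideal.mem_span_singleton]
  rw [this]
  exact isClosed_closedBall.preimage continuous_disc

/-- The set `{f ∈ V_{ℤ_p} : p² ∣ Δ(f)}` is measurable. [folklore] -/
theorem measurableSet_setOf_sq_dvd_disc :
    MeasurableSet {f : BinaryQuartic ℤ_[p] | (p : ℤ_[p]) ^ 2 ∣ f.disc} :=
  isClosed_setOf_sq_dvd_disc.measurableSet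

variable (p) in
/-- **`μ_p{f ∈ V_{ℤ_p} : p² ∣ Δ(f)} ≤ 10/p²` for every prime `p`** — the estimate
`∫_{f ∈ V_{ℤ_p}, p² ∣ Δ(f)} df ≪ p⁻²` of the proof of Thm 2.21 of Bhargava–Shankar 2015 (display
following "since `φ` is acceptable"; there attributed to [BPS, proof of Thm 3.2]) with an explicit
constant, for the normalised measure `μ_p` on `V_{ℤ_p}` (`μ_p(V_{ℤ_p}) = 1`). Proof: the set is the
union over the `≤ 10p⁸` zeros `F` of `Δ` in `V(ℤ/p²)` (`card_filter_disc_eq_zero_sq_le`) of the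
residue classes `{f ≡ F}`, each of measure `p⁻¹⁰`. [cite: BhargavaShankarAnnals2015, §2.7, proof of Thm 2.21 (published numbering)] -/
theorem padicInt_volume_setOf_sq_dvd_disc_le :
    volume {f : BinaryQuartic ℤ_[p] | (p : ℤ_[p]) ^ 2 ∣ f.disc} ≤ 10 * ((p : ℝ≥0∞) ^ 2)⁻¹ := by
  set Z := (Finset.univ.filter fun F : BinaryQuartic (ZMod (p ^ 2)) => F.disc = 0) with hZ
  have hS : {f : BinaryQuartic ℤ_[p] | (p : ℤ_[p]) ^ 2 ∣ f.disc} =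
      ⋃ F ∈ Z, {f | f.map (PadicInt.toZModPow 2) = F} := by
    ext f
    simp only [mem_setOf_eq, mem_iUnion, hZ, Finset.mem_filter, Finset.mem_univ, true_and,
      exists_prop, exists_eq_right', sq_dvd_disc_iff_disc_map_toZModPow]
  have hp0 : (p : ℝ≥0∞) ≠ 0 := by exact_mod_cast hp.out.ne_zero
  have h8 : (p : ℝ≥0∞) ^ 8 ≠ 0 := pow_ne_zero _ hp0
  have h8T : (p : ℝ≥0∞) ^ 8 ≠ ⊤ := ENNReal.pow_ne_top (ENNReal.natCast_ne_top p)
  rw [hS]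
  calc volume (⋃ F ∈ Z, {f : BinaryQuartic ℤ_[p] | f.map (PadicInt.toZModPow 2) = F})
        ≤ ∑ F ∈ Z, volume {f : BinaryQuartic ℤ_[p] | f.map (PadicInt.toZModPow 2) = F} :=
          measure_biUnion_finset_le Z _
    _ = Z.card * ((((p : ℝ≥0∞) ^ 2)⁻¹) ^ 5) := by
          simp only [volume_setOf_map_toZModPow_eq, Finset.sum_const, nsmul_eq_mul]
    _ ≤ ((10 * p ^ 8 : ℕ) : ℝ≥0∞) * ((((p : ℝ≥0∞) ^ 2)⁻¹) ^ 5) := by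
          gcongr
          exact_mod_cast card_filter_disc_eq_zero_sq_le p
    _ = 10 * ((p : ℝ≥0∞) ^ 8 * ((p : ℝ≥0∞) ^ 8)⁻¹) * ((p : ℝ≥0∞) ^ 2)⁻¹ := by
          rw [← ENNReal.inv_pow, ← pow_mul, show 2 * 5 = 8 + 2 by norm_num, pow_add,
            ENNReal.mul_inv (Or.inl h8) (Or.inl h8T)]
          push_cast
          ring
    _ = 10 * ((p : ℝ≥0∞) ^ 2)⁻¹ := by rw [ENNReal.mul_inv_cancel h8 h8T, mul_one]

variable (p) in
/-- Real-valued form of `padicInt_volume_setOf_sq_dvd_disc_le`: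
`μ_p{f ∈ V_{ℤ_p} : p² ∣ Δ(f)} ≤ 10/p²` (as needed for `∑_p` and `∏_p` estimates).
[cite: BhargavaShankarAnnals2015, §2.7, proof of Thm 2.21 (published numbering)] -/
theorem padicInt_volume_real_setOf_sq_dvd_disc_le :
    (volume {f : BinaryQuartic ℤ_[p] | (p : ℤ_[p]) ^ 2 ∣ f.disc}).toReal ≤ 10 / (p : ℝ) ^ 2 := by
  have hp0 : (p : ℝ≥0∞) ≠ 0 := by exact_mod_cast hp.out.ne_zero
  have h := padicInt_volume_setOf_sq_dvd_disc_le p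
  have hfin : 10 * ((p : ℝ≥0∞) ^ 2)⁻¹ ≠ ⊤ :=
    ENNReal.mul_ne_top (by norm_num) (ENNReal.inv_ne_top.mpr (pow_ne_zero _ hp0))
  have hval : (10 * ((p : ℝ≥0∞) ^ 2)⁻¹).toReal = 10 / (p : ℝ) ^ 2 := by
    rw [ENNReal.toReal_mul, ENNReal.toReal_inv, ENNReal.toReal_pow, ENNReal.toReal_natCast,
      div_eq_mul_inv]
    norm_num
  rw [← hval]
  exact ENNReal.toReal_mono hfin h

end Density

end BinaryQuartic

end Literature.NumberTheory.EllipticCurves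

end
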